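import Mathlib
import Summits.MatrixMultiplication.Statement
import Summits.MatrixMultiplication.MatrixMultiplication.Theorems.GraphEquationsOneSidedSyzygies
import Summits.MatrixMultiplication.MatrixMultiplication.Theorems.GraphEquationsTorusWeights

/-!
# GraphEquations — shapes of the weighted components of a cubic (M42b; cell `decomp-mm`, lens-5 g40)

Helper kernel beneath the attacked crux `MultiplicityReduction` (stmt-MatrixMultiplication-27806) of
route `GraphEquations`, rung `K = 3`; second third of the CUBIC NORMAL FORM `NFₙ`.  A monomial of total
degree `≤ 3` and torus weight `m` (`GraphEquationsTorusWeights.wt`) has a rigid SHAPE as a function of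
`(A,B,C)`, found by sorting its variables: weight `(3,3)` ⇒ `K(C)` (`readC`); `(3,2)` / `(2,3)` ⇒
`Σ α_{qq'}(A) c_q c_{q'}` / the same in `B` (`readAQ`, `readBQ`, the format of the quadratic one-sided
syzygies of M39); `(3,1)` / `(1,3)` ⇒ `Σ α_q(A) c_q` / in `B` (`readAL`, `readBL`, the one-sided syzygies of
M38); `(2,2)` ⇒ `⟨S C, C⟩ + Σ_q β_q(A,B) c_q` (`readCC`, a matrix plus a bilinear tensor as in M36); every
other weight has `m₁ + m₂ ≤ 3` and the LOW shape `R(A,B) + ⟨κ + L_A A + L_B B, C⟩` (`readLow`).  The shapes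
are additive (`HasForm`, `hasForm_sum`), so they pass to sums of monomials (the weighted homogeneous
components of a cubic: `GraphEquationsCubicNormalForm.hasForm_component`).  Sorry-free.
-/

set_option linter.dupNamespace false
set_option linter.unusedSectionVars false

noncomputable section

namespace Summit.MatrixMultiplication.MatrixMultiplication.Theorems.GraphEquations

open MvPolynomial Matrix

variable {n : ℕ}
/-! ## Shapes: read-outs of coefficient data as functions of `(A, B, C)` -/

/-- The space of functions of `(A, B, C)`. -/
abbrev Fn3 (n : ℕ) : Type := Vec n → Vec n → Vec n → ℂ

/-- `p` HAS FORM `F`: as a function of `(A,B,C)`, `p` is the read-out `F d` of some datum `d`. -/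
def HasForm {D : Type*} [AddCommMonoid D] (F : D →+ Fn3 n) (p : MvPolynomial (GraphVars n) ℂ) : Prop :=
  ∃ d : D, ∀ A B C : Vec n, eval (pt A B C) p = F d A B C

section HasForm

variable {D : Type*} [AddCommMonoid D] (F : D →+ Fn3 n)

/-- `0` has every form. -/
theorem hasForm_zero : HasForm F 0 :=
  ⟨0, fun A B C => by rw [map_zero, map_zero]; rfl⟩

/-- Forms are additive. -/
theorem hasForm_add {p q : MvPolynomial (GraphVars n) ℂ} (hp : HasForm F p) (hq : HasForm F q) :
    HasForm F (p + q) := by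
  obtain ⟨d, hd⟩ := hp
  obtain ⟨e, he⟩ := hq
  exact ⟨d + e, fun A B C => by rw [map_add, map_add, hd, he]; rfl⟩

/-- Forms are additive (finite sums). -/
theorem hasForm_sum {ι : Type*} (s : Finset ι) (f : ι → MvPolynomial (GraphVars n) ℂ)
    (h : ∀ i ∈ s, HasForm F (f i)) : HasForm F (∑ i ∈ s, f i) := by
  classical
  induction s using Finset.induction_on with
  | empty => rw [Finset.sum_empty]; exact hasForm_zero F
  | insert i s hi ih =>
    rw [Finset.sum_insert hi]
    exact hasForm_add F (h i (Finset.mem_insert_self i s))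
      (ih fun j hj => h j (Finset.mem_insert_of_mem hj))

end HasForm

/-- `bilFormEval` is additive in the coefficient family. -/
theorem bilFormEval_add (α β : TwoSided n) (P x y : Vec n) :
    bilFormEval (α + β) P x y = bilFormEval α P x y + bilFormEval β P x y := by
  simp only [bilFormEval, Pi.add_apply, map_add, add_mul, Finset.sum_add_distrib]

/-- `bilEval` is additive in the coefficient tensor. -/
theorem bilEval_add (Bc Bc' : BilCoeff n) (q : Fin n × Fin n) (A B : Vec n) :
    bilEval (Bc + Bc') q A B = bilEval Bc q A B + bilEval Bc' q A B := by
  simp only [bilEval, Pi.add_apply, add_mul, Finset.sum_add_distrib]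

/-- Read-out of weight `(3,3)`: a polynomial `K(C)`. -/
def readC : MvPolynomial (Fin n × Fin n) ℂ →+ Fn3 n where
  toFun K := fun _ _ C => eval C K
  map_zero' := by funext A B C; simp
  map_add' K K' := by funext A B C; simp

/-- Read-out of weight `(3,2)`: `Σ_{q,q'} α_{qq'}(A) c_q c_{q'}`. -/
def readAQ : TwoSided n →+ Fn3 n where
  toFun α := fun A _ C => bilFormEval α A C C
  map_zero' := by funext A B C; simp [bilFormEval]
  map_add' α β := by funext A B C; exact bilFormEval_add α β A C C

/-- Read-out of weight `(2,3)`: `Σ_{q,q'} α_{qq'}(B) c_q c_{q'}`. -/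
def readBQ : TwoSided n →+ Fn3 n where
  toFun α := fun _ B C => bilFormEval α B C C
  map_zero' := by funext A B C; simp [bilFormEval]
  map_add' α β := by funext A B C; exact bilFormEval_add α β B C C

/-- Read-out of weight `(3,1)`: `Σ_q α_q(A) c_q`. -/
def readAL : OneSided n →+ Fn3 n where
  toFun α := fun A _ C => ∑ q, eval A (α q) * C q
  map_zero' := by funext A B C; simp
  map_add' α β := by funext A B C; simp [add_mul, Finset.sum_add_distrib]

/-- Read-out of weight `(1,3)`: `Σ_q α_q(B) c_q`. -/
def readBL : OneSided n →+ Fn3 n where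
  toFun α := fun _ B C => ∑ q, eval B (α q) * C q
  map_zero' := by funext A B C; simp
  map_add' α β := by funext A B C; simp [add_mul, Finset.sum_add_distrib]

/-- Read-out of weight `(2,2)`: `⟨S C, C⟩ + Σ_q β_q(A,B) c_q` (`S` a matrix, `β` bilinear). -/
def readCC : (SqMat n × BilCoeff n) →+ Fn3 n where
  toFun d := fun A B C => (d.1 *ᵥ C) ⬝ᵥ C + ∑ q, bilEval d.2 q A B * C q
  map_zero' := by funext A B C; simp [bilEval]
  map_add' d e := by
    funext A B C
    simp only [Prod.fst_add, Prod.snd_add, Pi.add_apply, add_mulVec, add_dotProduct, bilEval_add, add_mul,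
      Finset.sum_add_distrib]
    ring

/-- The LOW read-out: `R(A,B) + ⟨κ + L_A A + L_B B, C⟩`. -/
def readLow : ((Vec n → Vec n → ℂ) × Vec n × SqMat n × SqMat n) →+ Fn3 n where
  toFun d := fun A B C => d.1 A B + (d.2.1 + d.2.2.1 *ᵥ A + d.2.2.2 *ᵥ B) ⬝ᵥ C
  map_zero' := by funext A B C; simp
  map_add' d e := by
    funext A B C
    simp only [Prod.fst_add, Prod.snd_add, Pi.add_apply, add_mulVec, add_dotProduct]
    ring

/-! ## Shapes of monomials of degree `≤ 3`, by weight -/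

/-- `Σ_p Σ_{p'} [p = q ∧ p' = q'] f p p' = f q q'`. -/
theorem sum_sum_ite_and_eq {X : Type*} [Fintype X] [DecidableEq X] (q q' : X) (f : X → X → ℂ) :
    (∑ p, ∑ p', if p = q ∧ p' = q' then f p p' else 0) = f q q' := by
  rw [Finset.sum_eq_single q]
  · simp
  · intro p _ hp; simp [hp]
  · simp

/-- The named weights, where the shape is constrained by a syzygy theorem. -/
def named : Finset (ℕ × ℕ) := {(3, 3), (3, 2), (2, 3), (3, 1), (1, 3), (2, 2)}

/-- Membership in `named`, arithmetically. -/
theorem mem_named_iff (m : ℕ × ℕ) : m ∈ named ↔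
    (m.1 = 3 ∧ m.2 = 3) ∨ (m.1 = 3 ∧ m.2 = 2) ∨ (m.1 = 2 ∧ m.2 = 3) ∨ (m.1 = 3 ∧ m.2 = 1) ∨
      (m.1 = 1 ∧ m.2 = 3) ∨ (m.1 = 2 ∧ m.2 = 2) := by
  obtain ⟨a, b⟩ := m
  simp only [named, Finset.mem_insert, Finset.mem_singleton, Prod.mk.injEq]

/-- `Σ_{m named} f m`, spelled out. -/
theorem sum_named {M : Type*} [AddCommMonoid M] (f : ℕ × ℕ → M) :
    ∑ m ∈ named, f m = f (3, 3) + f (3, 2) + f (2, 3) + f (3, 1) + f (1, 3) + f (2, 2) := by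
  rw [named, Finset.sum_insert (by simp), Finset.sum_insert (by simp), Finset.sum_insert (by simp),
    Finset.sum_insert (by simp), Finset.sum_insert (by simp), Finset.sum_singleton]
  simp only [add_assoc]

section Monomials

variable {d : GraphVars n →₀ ℕ} (hdeg : (d.sum fun _ e => e) ≤ 3) (c : ℂ)
include hdeg

/-- Weight `(3,3)`: a pure `C`-cubic. -/
theorem hasForm_monomial_33 (hw : Finsupp.weight wt d = (3, 3)) : HasForm readC (monomial d c) := by
  classical
  obtain ⟨sa, sb, sc, rfl⟩ := exists_sorted d
  rw [weight_sorted, Prod.mk.injEq] at hw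
  rw [degree_toFinsupp, card_sorted] at hdeg
  obtain ⟨ha, hb⟩ : Multiset.card sa = 0 ∧ Multiset.card sb = 0 := by omega
  rw [Multiset.card_eq_zero] at ha hb
  subst ha hb
  refine ⟨C c * (sc.map X).prod, fun A B C => ?_⟩
  rw [eval_pt_monomial_sorted]
  show _ = eval C (MvPolynomial.C c * (sc.map X).prod)
  rw [eval_C_mul_prod_map_X]; simp

/-- Weight `(3,2)`: `a · c · c'`. -/
theorem hasForm_monomial_32 (hw : Finsupp.weight wt d = (3, 2)) : HasForm readAQ (monomial d c) := by
  classical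
  obtain ⟨sa, sb, sc, rfl⟩ := exists_sorted d
  rw [weight_sorted, Prod.mk.injEq] at hw
  rw [degree_toFinsupp, card_sorted] at hdeg
  obtain ⟨ha, hb, hc⟩ : Multiset.card sa = 1 ∧ Multiset.card sb = 0 ∧ Multiset.card sc = 2 := by omega
  rw [Multiset.card_eq_zero] at hb
  obtain ⟨v, rfl⟩ := Multiset.card_eq_one.1 ha
  obtain ⟨q, q', rfl⟩ := Multiset.card_eq_two.1 hc
  subst hb
  refine ⟨fun p p' => if p = q ∧ p' = q' then C c * X v else 0, fun A B C => ?_⟩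
  rw [eval_pt_monomial_sorted]
  show _ = bilFormEval _ A C C
  simp only [bilFormEval]
  have : ∀ p p', eval A (if p = q ∧ p' = q' then MvPolynomial.C c * X v else 0) * C p * C p'
      = if p = q ∧ p' = q' then c * A v * C p * C p' else 0 := by
    intro p p'; split_ifs <;> simp
  simp only [this, sum_sum_ite_and_eq, prod_map_zero', prod_map_singleton', prod_map_pair']; ring

/-- Weight `(2,3)`: `b · c · c'`. -/
theorem hasForm_monomial_23 (hw : Finsupp.weight wt d = (2, 3)) : HasForm readBQ (monomial d c) := by
  classical
  obtain ⟨sa, sb, sc, rfl⟩ := exists_sorted d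
  rw [weight_sorted, Prod.mk.injEq] at hw
  rw [degree_toFinsupp, card_sorted] at hdeg
  obtain ⟨ha, hb, hc⟩ : Multiset.card sa = 0 ∧ Multiset.card sb = 1 ∧ Multiset.card sc = 2 := by omega
  rw [Multiset.card_eq_zero] at ha
  obtain ⟨w, rfl⟩ := Multiset.card_eq_one.1 hb
  obtain ⟨q, q', rfl⟩ := Multiset.card_eq_two.1 hc
  subst ha
  refine ⟨fun p p' => if p = q ∧ p' = q' then C c * X w else 0, fun A B C => ?_⟩
  rw [eval_pt_monomial_sorted]
  show _ = bilFormEval _ B C C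
  simp only [bilFormEval]
  have : ∀ p p', eval B (if p = q ∧ p' = q' then MvPolynomial.C c * X w else 0) * C p * C p'
      = if p = q ∧ p' = q' then c * B w * C p * C p' else 0 := by
    intro p p'; split_ifs <;> simp
  simp only [this, sum_sum_ite_and_eq, prod_map_zero', prod_map_singleton', prod_map_pair']; ring

/-- Weight `(3,1)`: `a · a' · c`. -/
theorem hasForm_monomial_31 (hw : Finsupp.weight wt d = (3, 1)) : HasForm readAL (monomial d c) := by
  classical
  obtain ⟨sa, sb, sc, rfl⟩ := exists_sorted d
  rw [weight_sorted, Prod.mk.injEq] at hw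
  rw [degree_toFinsupp, card_sorted] at hdeg
  obtain ⟨ha, hb, hc⟩ : Multiset.card sa = 2 ∧ Multiset.card sb = 0 ∧ Multiset.card sc = 1 := by omega
  rw [Multiset.card_eq_zero] at hb
  obtain ⟨v, v', rfl⟩ := Multiset.card_eq_two.1 ha
  obtain ⟨q, rfl⟩ := Multiset.card_eq_one.1 hc
  subst hb
  refine ⟨fun p => if p = q then C c * X v * X v' else 0, fun A B C => ?_⟩
  rw [eval_pt_monomial_sorted]
  show _ = ∑ p, eval A (if p = q then MvPolynomial.C c * X v * X v' else 0) * C p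
  have : ∀ p, eval A (if p = q then MvPolynomial.C c * X v * X v' else 0) * C p
      = if p = q then c * A v * A v' * C p else 0 := by
    intro p; split_ifs <;> simp
  simp only [this, Finset.sum_ite_eq', Finset.mem_univ, if_true, prod_map_zero', prod_map_singleton',
    prod_map_pair']; ring

/-- Weight `(1,3)`: `b · b' · c`. -/
theorem hasForm_monomial_13 (hw : Finsupp.weight wt d = (1, 3)) : HasForm readBL (monomial d c) := by
  classical
  obtain ⟨sa, sb, sc, rfl⟩ := exists_sorted d
  rw [weight_sorted, Prod.mk.injEq] at hw
  rw [degree_toFinsupp, card_sorted] at hdeg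
  obtain ⟨ha, hb, hc⟩ : Multiset.card sa = 0 ∧ Multiset.card sb = 2 ∧ Multiset.card sc = 1 := by omega
  rw [Multiset.card_eq_zero] at ha
  obtain ⟨w, w', rfl⟩ := Multiset.card_eq_two.1 hb
  obtain ⟨q, rfl⟩ := Multiset.card_eq_one.1 hc
  subst ha
  refine ⟨fun p => if p = q then C c * X w * X w' else 0, fun A B C => ?_⟩
  rw [eval_pt_monomial_sorted]
  show _ = ∑ p, eval B (if p = q then MvPolynomial.C c * X w * X w' else 0) * C p
  have : ∀ p, eval B (if p = q then MvPolynomial.C c * X w * X w' else 0) * C p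
      = if p = q then c * B w * B w' * C p else 0 := by
    intro p; split_ifs <;> simp
  simp only [this, Finset.sum_ite_eq', Finset.mem_univ, if_true, prod_map_zero', prod_map_singleton',
    prod_map_pair']; ring

/-- Weight `(2,2)`: `c · c'` or `a · b · c`. -/
theorem hasForm_monomial_22 (hw : Finsupp.weight wt d = (2, 2)) : HasForm readCC (monomial d c) := by
  classical
  obtain ⟨sa, sb, sc, rfl⟩ := exists_sorted d
  rw [weight_sorted, Prod.mk.injEq] at hw
  rw [degree_toFinsupp, card_sorted] at hdeg
  obtain ⟨ha, hb, hc⟩ | ⟨ha, hb, hc⟩ :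
      (Multiset.card sa = 0 ∧ Multiset.card sb = 0 ∧ Multiset.card sc = 2) ∨
      (Multiset.card sa = 1 ∧ Multiset.card sb = 1 ∧ Multiset.card sc = 1) := by omega
  · rw [Multiset.card_eq_zero] at ha hb
    obtain ⟨q, q', rfl⟩ := Multiset.card_eq_two.1 hc
    subst ha hb
    refine ⟨(Matrix.of fun p p' => if p = q ∧ p' = q' then c else 0, 0), fun A B C => ?_⟩
    rw [eval_pt_monomial_sorted]
    show _ = ((Matrix.of fun p p' => if p = q ∧ p' = q' then c else 0) *ᵥ C) ⬝ᵥ C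
      + ∑ p, bilEval (0 : BilCoeff n) p A B * C p
    have h1 : ((Matrix.of fun p p' => if p = q ∧ p' = q' then c else 0) *ᵥ C) ⬝ᵥ C
        = ∑ p, ∑ p', if p = q ∧ p' = q' then c * C p' * C p else 0 := by
      simp only [dotProduct, mulVec, Matrix.of_apply, Finset.sum_mul]
      refine Finset.sum_congr rfl fun p _ => Finset.sum_congr rfl fun p' _ => ?_
      split_ifs <;> simp
    rw [h1, sum_sum_ite_and_eq]
    simp only [bilEval, Pi.zero_apply, zero_mul, Finset.sum_const_zero, add_zero, prod_map_zero',
      prod_map_pair']; ring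
  · obtain ⟨v, rfl⟩ := Multiset.card_eq_one.1 ha
    obtain ⟨w, rfl⟩ := Multiset.card_eq_one.1 hb
    obtain ⟨q, rfl⟩ := Multiset.card_eq_one.1 hc
    refine ⟨(0, fun p v' w' => if p = q then (if v' = v ∧ w' = w then c else 0) else 0), fun A B C => ?_⟩
    rw [eval_pt_monomial_sorted]
    show _ = ((0 : SqMat n) *ᵥ C) ⬝ᵥ C + ∑ p, bilEval _ p A B * C p
    have h1 : ∀ p, bilEval (fun p v' w' => if p = q then (if v' = v ∧ w' = w then c else 0) else 0) p A B
        = if p = q then c * A v * B w else 0 := by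
      intro p
      rcases eq_or_ne p q with rfl | hp
      · rw [if_pos rfl]
        simp only [bilEval, if_true]
        have : ∀ v' w', (if v' = v ∧ w' = w then c else 0) * A v' * B w'
            = if v' = v ∧ w' = w then c * A v' * B w' else 0 := by
          intro v' w'; split_ifs <;> simp
        simp only [this, sum_sum_ite_and_eq]
      · rw [if_neg hp]; simp [bilEval, hp]
    simp only [h1, zero_mulVec, zero_dotProduct, zero_add]
    have h2 : ∀ p, (if p = q then c * A v * B w else 0) * C p = if p = q then c * A v * B w * C p else 0 := by
      intro p; split_ifs <;> simp
    simp only [h2, Finset.sum_ite_eq', Finset.mem_univ, if_true, prod_map_singleton']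

/-- Every other weight: `R(A,B) + ⟨κ + L_A A + L_B B, C⟩`. -/
theorem hasForm_monomial_low (hw : Finsupp.weight wt d ∉ named) : HasForm readLow (monomial d c) := by
  classical
  obtain ⟨sa, sb, sc, rfl⟩ := exists_sorted d
  rw [weight_sorted, mem_named_iff] at hw
  rw [degree_toFinsupp, card_sorted] at hdeg
  have hcases : Multiset.card sc = 0 ∨
      (Multiset.card sc = 1 ∧ Multiset.card sa = 0 ∧ Multiset.card sb = 0) ∨
      (Multiset.card sc = 1 ∧ Multiset.card sa = 1 ∧ Multiset.card sb = 0) ∨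
      (Multiset.card sc = 1 ∧ Multiset.card sa = 0 ∧ Multiset.card sb = 1) := by
    simp only at hw
    omega
  rcases hcases with hc | ⟨hc, ha, hb⟩ | ⟨hc, ha, hb⟩ | ⟨hc, ha, hb⟩
  · rw [Multiset.card_eq_zero] at hc; subst hc
    refine ⟨(fun A B => c * (sa.map A).prod * (sb.map B).prod, 0, 0, 0), fun A B C => ?_⟩
    rw [eval_pt_monomial_sorted]
    show _ = c * (sa.map A).prod * (sb.map B).prod + ((0 : Vec n) + (0 : SqMat n) *ᵥ A + (0 : SqMat n) *ᵥ B) ⬝ᵥ C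
    simp
  · rw [Multiset.card_eq_zero] at ha hb; subst ha hb
    obtain ⟨q, rfl⟩ := Multiset.card_eq_one.1 hc
    refine ⟨(0, fun p => if p = q then c else 0, 0, 0), fun A B C => ?_⟩
    rw [eval_pt_monomial_sorted]
    show _ = (0 : Vec n → Vec n → ℂ) A B
      + ((fun p => if p = q then c else 0) + (0 : SqMat n) *ᵥ A + (0 : SqMat n) *ᵥ B) ⬝ᵥ C
    simp only [Pi.zero_apply, zero_add, zero_mulVec, add_zero, dotProduct, ite_mul, zero_mul,
      Finset.sum_ite_eq', Finset.mem_univ, if_true, prod_map_zero', prod_map_singleton']; ring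
  · rw [Multiset.card_eq_zero] at hb; subst hb
    obtain ⟨q, rfl⟩ := Multiset.card_eq_one.1 hc
    obtain ⟨v, rfl⟩ := Multiset.card_eq_one.1 ha
    refine ⟨(0, 0, Matrix.of fun p v' => if p = q ∧ v' = v then c else 0, 0), fun A B C => ?_⟩
    rw [eval_pt_monomial_sorted]
    show _ = (0 : Vec n → Vec n → ℂ) A B
      + ((0 : Vec n) + (Matrix.of fun p v' => if p = q ∧ v' = v then c else 0) *ᵥ A + (0 : SqMat n) *ᵥ B) ⬝ᵥ C
    have : ((Matrix.of fun p v' => if p = q ∧ v' = v then c else 0) *ᵥ A) ⬝ᵥ C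
        = ∑ p, ∑ v', if p = q ∧ v' = v then c * A v' * C p else 0 := by
      simp only [dotProduct, mulVec, Matrix.of_apply, Finset.sum_mul]
      refine Finset.sum_congr rfl fun p _ => Finset.sum_congr rfl fun v' _ => ?_
      split_ifs <;> simp
    simp only [Pi.zero_apply, zero_add, zero_mulVec, add_zero, this, sum_sum_ite_and_eq, prod_map_zero',
      prod_map_singleton']; ring
  · rw [Multiset.card_eq_zero] at ha; subst ha
    obtain ⟨q, rfl⟩ := Multiset.card_eq_one.1 hc
    obtain ⟨w, rfl⟩ := Multiset.card_eq_one.1 hb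
    refine ⟨(0, 0, 0, Matrix.of fun p w' => if p = q ∧ w' = w then c else 0), fun A B C => ?_⟩
    rw [eval_pt_monomial_sorted]
    show _ = (0 : Vec n → Vec n → ℂ) A B
      + ((0 : Vec n) + (0 : SqMat n) *ᵥ A + (Matrix.of fun p w' => if p = q ∧ w' = w then c else 0) *ᵥ B) ⬝ᵥ C
    have : ((Matrix.of fun p w' => if p = q ∧ w' = w then c else 0) *ᵥ B) ⬝ᵥ C
        = ∑ p, ∑ w', if p = q ∧ w' = w then c * B w' * C p else 0 := by
      simp only [dotProduct, mulVec, Matrix.of_apply, Finset.sum_mul]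
      refine Finset.sum_congr rfl fun p _ => Finset.sum_congr rfl fun w' _ => ?_
      split_ifs <;> simp
    simp only [Pi.zero_apply, zero_add, zero_mulVec, this, sum_sum_ite_and_eq, prod_map_zero',
      prod_map_singleton']; ring

end Monomials

end Summit.MatrixMultiplication.MatrixMultiplication.Theorems.GraphEquations

end
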